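import Summits.MatrixMultiplication.OmegaCensus.DicyclicLawReduction
import Mathlib.GroupTheory.SpecificGroups.Quaternion
import HarnessLib

/-!
# `C₂² × Q_{4m}`, `m ≡ 4 (mod 6)`: no two-domino triple attains the dicyclic law `(64m − 16)/3`

ω-census `pub-omega`, family (b3), seat pub-omega-group gen 11.  Framing: lottery ticket; floor = certified bounds/negative
ranges.  VALUE: a kernel clause of the census table (group-theoretic method); NOT progress on ω.

The census window for `β(C₂² × Q_{4m})`, `m ≡ 4 (mod 6)`, is `[(64m−64)/3, (64m−16)/3]` (`c2c2_quaternion_window_mod_six_four`).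
Here `C₂² × Q_{4m} = G(ℤ₂ × ℤ₂ × ℤ_{2m}, (0,0,m))` with the explicit presentation
`ρ(x,y,z) = (x, y, a^z)`, `τ(x,y,z) = (x, y, x a^z)`, and `A/⟨c₀⟩ = ℤ₂² × ℤ_m ↠ 𝔽₂³` (`m` even).  By
`no_dicyclic_law_of_two_domino'` (`DicyclicLawReduction.lean`): **no TPP triple in which `S` and `T` each meet both cosets
`C₂² × ⟨a⟩` and `C₂² × x⟨a⟩` in exactly one element attains `3|S||T||U| + 16 = 64m`** (`c2c2_quaternion_no_two_domino_dicyclic_law`).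
The value at `m = 4` is `β(C₂² × Q₁₆) = 64` (certified ×2 by enumeration and SAT, `pub-omega-group-g11/FAMILY-B-ADDENDUM-g11.md` §4);
the remaining shape classes (balanced / N1 / N2 / N3 of the addendum) are open for general `m`.
-/

namespace Summit.MatrixMultiplication.OmegaCensus

open Literature.Combinatorics.Additive Finset

variable {m : ℕ} [NeZero m]

omit [NeZero m] in
/-- `(m : ZMod 2) = 0` for even `m`. [folklore] -/
theorem natCast_zmod_two_eq_zero_of_even (hm : 2 ∣ m) : ((m : ℕ) : ZMod 2) = 0 :=
  (ZMod.natCast_eq_zero_iff m 2).2 hm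

/-- **`C₂² × Q_{4m}`, `m ≡ 4 (mod 6)`: no two-domino dicyclic-law triple.**  With
`ρ(x,y,z) = (x, y, a^z)`, `τ(x,y,z) = (x, y, x a^z)`: if `S` and `T` each contain exactly one `ρ`-element and one `τ`-element, then
`3|S||T||U| + 16 ≠ 64m` for every TPP triple `(S, T, U)`. [folklore] -/
theorem c2c2_quaternion_no_two_domino_dicyclic_law (hm6 : m % 6 = 4)
    {S T U : Finset (Multiplicative (ZMod 2) × (Multiplicative (ZMod 2) × QuaternionGroup m))}
    (h : TripleProductProperty S T U)
    (hs₀ : (univ.filter fun p : ZMod 2 × (ZMod 2 × ZMod (2 * m)) =>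
      ((Multiplicative.ofAdd p.1, (Multiplicative.ofAdd p.2.1, QuaternionGroup.a p.2.2)) :
        Multiplicative (ZMod 2) × (Multiplicative (ZMod 2) × QuaternionGroup m)) ∈ S).card = 1)
    (hs₁ : (univ.filter fun p : ZMod 2 × (ZMod 2 × ZMod (2 * m)) =>
      ((Multiplicative.ofAdd p.1, (Multiplicative.ofAdd p.2.1, QuaternionGroup.xa p.2.2)) :
        Multiplicative (ZMod 2) × (Multiplicative (ZMod 2) × QuaternionGroup m)) ∈ S).card = 1)
    (ht₀ : (univ.filter fun p : ZMod 2 × (ZMod 2 × ZMod (2 * m)) =>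
      ((Multiplicative.ofAdd p.1, (Multiplicative.ofAdd p.2.1, QuaternionGroup.a p.2.2)) :
        Multiplicative (ZMod 2) × (Multiplicative (ZMod 2) × QuaternionGroup m)) ∈ T).card = 1)
    (ht₁ : (univ.filter fun p : ZMod 2 × (ZMod 2 × ZMod (2 * m)) =>
      ((Multiplicative.ofAdd p.1, (Multiplicative.ofAdd p.2.1, QuaternionGroup.xa p.2.2)) :
        Multiplicative (ZMod 2) × (Multiplicative (ZMod 2) × QuaternionGroup m)) ∈ T).card = 1) :
    3 * (S.card * T.card * U.card) + 16 ≠ 8 * (8 * m) := by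
  haveI : NeZero (2 * m) := ⟨by have := NeZero.ne m; omega⟩
  -- the presentation `G(ℤ₂ × ℤ₂ × ℤ_{2m}, (0, 0, m))`
  let ρ : ZMod 2 × (ZMod 2 × ZMod (2 * m)) → Multiplicative (ZMod 2) × (Multiplicative (ZMod 2) × QuaternionGroup m) :=
    fun p => (Multiplicative.ofAdd p.1, (Multiplicative.ofAdd p.2.1, QuaternionGroup.a p.2.2))
  let τ : ZMod 2 × (ZMod 2 × ZMod (2 * m)) → Multiplicative (ZMod 2) × (Multiplicative (ZMod 2) × QuaternionGroup m) :=
    fun p => (Multiplicative.ofAdd p.1, (Multiplicative.ofAdd p.2.1, QuaternionGroup.xa p.2.2))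
  let c₀ : ZMod 2 × (ZMod 2 × ZMod (2 * m)) := (0, (0, (m : ZMod (2 * m))))
  have hneg : ∀ x : ZMod 2, -x = x := fun x => ZMod.neg_eq_self_mod_two x
  have hρρ : ∀ a b, ρ a * ρ b = ρ (a + b) := fun a b => by
    simp only [ρ, Prod.mk_mul_mk, QuaternionGroup.a_mul_a, ← ofAdd_add, Prod.fst_add, Prod.snd_add]
  have hρτ : ∀ a b, ρ a * τ b = τ (b - a) := fun a b => by
    simp only [ρ, τ, Prod.mk_mul_mk, QuaternionGroup.a_mul_xa, ← ofAdd_add, Prod.fst_sub, Prod.snd_sub]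
    rw [sub_eq_add_neg b.1, hneg, add_comm b.1, sub_eq_add_neg b.2.1, hneg, add_comm b.2.1]
  have hτρ : ∀ a b, τ a * ρ b = τ (a + b) := fun a b => by
    simp only [ρ, τ, Prod.mk_mul_mk, QuaternionGroup.xa_mul_a, ← ofAdd_add, Prod.fst_add, Prod.snd_add]
  have hττ : ∀ a b, τ a * τ b = ρ (c₀ + b - a) := fun a b => by
    simp only [ρ, τ, c₀, Prod.mk_mul_mk, QuaternionGroup.xa_mul_xa, ← ofAdd_add, Prod.fst_sub, Prod.snd_sub, Prod.fst_add,
      Prod.snd_add, zero_add]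
    rw [sub_eq_add_neg b.1, hneg, add_comm b.1, sub_eq_add_neg b.2.1, hneg, add_comm b.2.1]
  have hρinj : Function.Injective ρ := fun a b hab => by
    simp only [ρ, Prod.mk.injEq, QuaternionGroup.a.injEq] at hab
    exact Prod.ext (Multiplicative.ofAdd.injective hab.1) (Prod.ext (Multiplicative.ofAdd.injective hab.2.1) hab.2.2)
  have hτinj : Function.Injective τ := fun a b hab => by
    simp only [τ, Prod.mk.injEq, QuaternionGroup.xa.injEq] at hab
    exact Prod.ext (Multiplicative.ofAdd.injective hab.1) (Prod.ext (Multiplicative.ofAdd.injective hab.2.1) hab.2.2)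
  have hne : ∀ a b, ρ a ≠ τ b := fun a b hab => by simp [ρ, τ] at hab
  have hsurj : ∀ g, (∃ a, ρ a = g) ∨ (∃ a, τ a = g) := fun g => by
    obtain ⟨i, j, q⟩ := g
    cases q with
    | a z => exact Or.inl ⟨(Multiplicative.toAdd i, (Multiplicative.toAdd j, z)), rfl⟩
    | xa z => exact Or.inr ⟨(Multiplicative.toAdd i, (Multiplicative.toAdd j, z)), rfl⟩
  have hc₀ : c₀ ≠ 0 := by
    intro h0
    have h1 : ((m : ℕ) : ZMod (2 * m)) = 0 := by simpa [c₀] using congrArg (fun p => p.2.2) h0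
    rw [ZMod.natCast_eq_zero_iff] at h1
    have := Nat.le_of_dvd (Nat.pos_of_ne_zero (NeZero.ne m)) h1
    omega
  have hcard : Fintype.card (ZMod 2 × (ZMod 2 × ZMod (2 * m))) = 8 * m := by
    rw [Fintype.card_prod, Fintype.card_prod, ZMod.card, ZMod.card]; ring
  -- the three characters `x`, `y`, `z mod 2` (all kill `c₀` since `m` is even) are jointly onto `𝔽₂³`
  have h2m : 2 ∣ m := by omega
  let ψ₁ : ZMod 2 × (ZMod 2 × ZMod (2 * m)) →+ ZMod 2 := AddMonoidHom.fst _ _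
  let ψ₂ : ZMod 2 × (ZMod 2 × ZMod (2 * m)) →+ ZMod 2 := (AddMonoidHom.fst _ _).comp (AddMonoidHom.snd _ _)
  let ψ₃ : ZMod 2 × (ZMod 2 × ZMod (2 * m)) →+ ZMod 2 :=
    (ZMod.castHom (show 2 ∣ 2 * m from dvd_mul_right 2 m) (ZMod 2)).toAddMonoidHom.comp
      ((AddMonoidHom.snd _ _).comp (AddMonoidHom.snd _ _))
  have hψ₃ : ∀ p : ZMod 2 × (ZMod 2 × ZMod (2 * m)),
      ψ₃ p = ZMod.castHom (show 2 ∣ 2 * m from dvd_mul_right 2 m) (ZMod 2) p.2.2 := fun p => rfl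
  have hψc : ψ₁ c₀ = 0 ∧ ψ₂ c₀ = 0 ∧ ψ₃ c₀ = 0 := by
    refine ⟨rfl, rfl, ?_⟩
    rw [hψ₃]
    show ZMod.castHom _ (ZMod 2) ((m : ℕ) : ZMod (2 * m)) = 0
    rw [map_natCast]; exact natCast_zmod_two_eq_zero_of_even h2m
  have hψ : ∀ v : ZMod 2 × ZMod 2 × ZMod 2, ∃ x, (ψ₁ x, ψ₂ x, ψ₃ x) = v := by
    rintro ⟨v₁, v₂, v₃⟩
    refine ⟨(v₁, (v₂, ((v₃.val : ℕ) : ZMod (2 * m)))), ?_⟩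
    simp only [Prod.mk.injEq]
    refine ⟨rfl, rfl, ?_⟩
    rw [hψ₃]
    show ZMod.castHom _ (ZMod 2) ((v₃.val : ℕ) : ZMod (2 * m)) = v₃
    rw [map_natCast, ZMod.natCast_zmod_val]
  have key := no_dicyclic_law_of_two_domino' hρρ hρτ hτρ hττ hc₀ hρinj hτinj hne hsurj (by rw [hcard]; omega)
    (by rw [hcard]; omega) ψ₁ ψ₂ ψ₃ hψc hψ h hs₀ hs₁ ht₀ ht₁
  rwa [hcard] at key

end Summit.MatrixMultiplication.OmegaCensus
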